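import Mathlib
import Literature.NumberTheory.EllipticCurves.PAdicOneVariableSeriesFamilyOfRelNormCoherentUnits
import Literature.NumberTheory.EllipticCurves.PAdicOneVariableUnitsSocketInjective
import Literature.NumberTheory.EllipticCurves.PAdicOneVariableCharacterSupport
import Literature.NumberTheory.EllipticCurves.PAdicOneVariableAffinePushforward

/-!
# STUB-IDEAS k2-g39 — «THE PRIMITIVE IS LOG-FREE»: R218 «PRIM₂» discharged on the MEASURE side
# (de Shalit I.3.3 (7′)/(8), I.3.5 (10)/(11) read backwards: `A_b := P_{(x⁻¹·D_{H_b})}`)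

Sketch for `stub_heegnerIndexLowerAtTwo` (crux `PrintCf2.SplitBadTwoLowerHalfOfFacts`, item
`stmt-BirchSwinnertonDyer-27851`), node R197a″ (i-a) of STUB-PLAN v7.1, sub-stub **R218 «PRIM₂»**
(CRITIC-ROWS-g38 row 111: `BoundedPrimitive H C` for the relative tilde family, priced S–M⁻ as
"`p`-adic `log̃_E` of a principal-unit Coleman series at `2`, I.3.3 integrality with zero margin").

THESIS.  The bounded `D`-primitive needs NO logarithm and NO `2`-adic estimate: for ANY bounded
`P ∈ 𝕜⟦S⟧` whose Amice distribution `D_P` lives on `ℤ_p^×` (the tree's ★★★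
`invAmice₁_μ_eq_zero_of_relTraceTwo_eq_zero` gives exactly this for `H_b = Θ(j((δ_E g_b)~)∘ϑ)`), the Amice
transform `A := P_ν` of the bounded distribution `ν := x⁻¹·D_P` (tree `density … unitInv`) satisfies
`‖[S^k]A‖ ≤ C` (same bound) and `mahlerD A = P` — because `D_{DA} = x·D_A = x·x⁻¹·D_P = D_P` levelwise
(tree `density_cast_invAmice₁_μ`, `μ_succ_eq_integral_density_unitInv`, Amice inversion
`invAmice₁_amice_μ` / `eq_of_invAmice₁_μ_eq`).  §1–§2 prove this (generic `p`, generic complete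
ultrametric `ℚ_p`-field `𝕜`); §3 instantiates it VERBATIM for the relative norm-coherent-units family of
`PAdicOneVariableSeriesFamilyOfRelNormCoherentUnits` (same hypotheses as ★ `seriesFamily_hsock_…`), i.e.
k3-g38's typed sub-stub `BoundedPrimitive` for that family; §4 proves that two `D`-primitives differ by a
constant (so the log-currency witness `Ω⁻¹Θ(log̃_E g_b∘ϑ)` of k1 is `A_b + const`, bounded FOR FREE:
de Shalit's Lemma I.3.3 (7) leaves the critical path); §5 the finite value formula
`Σ_k [S^k]A (ε−1)^k = Σ_{a mod p^n} ν(a)·ε^a` (what READ₂ reads); §6 the two remaining READ₂ inputs as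
typed `Prop`s (log-evaluation commutation; "the Frobenius-twist term dies on the units").

Everything in §1–§5 is proved (0 sorry); §6 are definitions of statements.  BSD is NOT proved by any of
this; neither is the crux nor the stub — this discharges ONE priced sub-node (R218) of the registered line
and retypes the inputs of the next one (R219).

References: [deShalit1987] I.3.1 (1)–(3) p. 16; I.3.3 (7), (7′), (8) p. 17; I.3.4 (10), I.3.5 (11) p. 18
(`lit read book:shalit1987-iwasawa-theory-elliptic-curves-with-complex-multiplication --pages 16-18`);
[MazurTateTeitelbaum1986Invent] §I.11; Coates–Sujatha, *Cyclotomic Fields and Zeta Values* Lemma 2.5.1.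
-/

set_option linter.dupNamespace false
set_option linter.style.longLine false
set_option linter.unusedSectionVars false

noncomputable section

namespace Summit.BirchSwinnertonDyer.BirchSwinnertonDyer.Cruxes.SplitBadTwoLowerHalfOfFacts.LogFreePrimitiveK2G39

open Literature.NumberTheory.EllipticCurves

/-! ### §1. Unit-supported distributions: every density `f·D` again lives on `ℤ_p^×` -/

section Generic

variable {p : ℕ} [Fact p.Prime]
variable {𝕜 : Type*} [NormedField 𝕜] [NormedAlgebra ℚ_[p] 𝕜] [IsUltrametricDist 𝕜] [CompleteSpace 𝕜]

/-- k3-g38's typed sub-stub **PRIM** (verbatim shape): every member of the family has a `D`-primitive with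
the family's bound. -/
def BoundedPrimitive {B : Type*} (H : B → PowerSeries 𝕜) (C : ℝ) : Prop :=
  ∀ b, ∃ A : PowerSeries 𝕜, (∀ m, ‖PowerSeries.coeff m A‖ ≤ C) ∧ mahlerD A = H b

/-- If `D` vanishes on every non-unit class (levels `≥ 1`), so does `f·D` for EVERY admissible density `f`
(the integrand `𝟙_b·f` vanishes on `ℤ_p^×`, where `D` lives: `∫ g dD = ∫ 𝟙_{ℤ_p^×} g dD`). -/
theorem density_μ_succ_eq_zero_of_forall (D : BoundedDistribution (ProfiniteTower.padicInt p) 𝕜)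
    (hsupp : ∀ (n : ℕ) (b : ZMod (p ^ (n + 1))), ¬ IsUnit b → D.μ (n + 1) b = 0)
    (f : ℤ_[p] → 𝕜) (hf : UniformContinuous f) (hf1 : ∀ x, ‖f x‖ ≤ 1) (n : ℕ) (b : ZMod (p ^ (n + 1)))
    (hb : ¬ IsUnit b) :
    (D.density (ProfiniteTower.padicInt_isUniform p) f hf hf1).μ (n + 1) b = 0 := by
  rw [BoundedDistribution.density_μ]
  have hcf : UniformContinuous (BoundedDistribution.cellFun (T := ProfiniteTower.padicInt p) (n + 1) b f) :=
    BoundedDistribution.uniformContinuous_cellFun (ProfiniteTower.padicInt_isUniform p) (n + 1) b hf hf1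
  have h0 : (fun x : ℤ_[p] ↦ (if IsUnit (PadicInt.toZModPow 1 x) then (1 : 𝕜) else 0) *
      BoundedDistribution.cellFun (T := ProfiniteTower.padicInt p) (n + 1) b f x) = fun _ ↦ 0 := by
    funext x
    rw [BoundedDistribution.cellFun_apply, ProfiniteTower.padicInt_proj]
    split_ifs with h1 h2
    · exact absurd (h2 ▸ (isUnit_toZModPow_succ_iff n x).mpr ((isUnit_toZModPow_one_iff x).mp h1)) hb
    · simp
    · simp
    · simp
  have hF : UniformContinuous (fun x : ℤ_[p] ↦ (if IsUnit (PadicInt.toZModPow 1 x) then (1 : 𝕜) else 0) *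
      BoundedDistribution.cellFun (T := ProfiniteTower.padicInt p) (n + 1) b f x) := by
    rw [h0]; exact uniformContinuous_const
  rw [← D.integral_restrictUnits_eq_of_forall hsupp hcf, integral_restrictUnits D hF, h0,
    D.integral_zero_fun]

/-! ### §2. THE LOG-FREE BOUNDED PRIMITIVE (de Shalit (7′)+(10)+(11) read backwards) -/

/-- ★★★ **R218 «PRIM₂», generic form.**  A power series `P` with `‖[S^k]P‖ ≤ C` whose distribution `D_P`
is supported on `ℤ_p^×` has a `D`-primitive with the SAME bound: `A := P_ν`, the Amice transform of the
bounded distribution `ν := x⁻¹·D_P`; then `D_{DA} = x·D_A = x·ν = D_P` levelwise, so `DA = P` by Amice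
inversion.  No logarithm, no `p`-adic estimate, every `p`. [deShalit1987, I.3.3 (7′)/(8), I.3.5 (10)/(11)] -/
theorem exists_bounded_mahlerD_eq_of_forall_μ_succ_eq_zero {P : PowerSeries 𝕜} {C : ℝ}
    (hC : ∀ k, ‖PowerSeries.coeff k P‖ ≤ C)
    (hsupp : ∀ (n : ℕ) (b : ZMod (p ^ (n + 1))), ¬ IsUnit b → (invAmice₁ p P hC).μ (n + 1) b = 0) :
    ∃ A : PowerSeries 𝕜, (∀ k, ‖PowerSeries.coeff k A‖ ≤ C) ∧ mahlerD A = P := by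
  -- `ν := x⁻¹ · D_P`, `A := P_ν`
  set ν := (invAmice₁ p P hC).density (ProfiniteTower.padicInt_isUniform p) (unitInv (p := p) 𝕜)
    uniformContinuous_unitInv norm_unitInv_le with hν
  have hA : ∀ k, ‖PowerSeries.coeff k ν.amice‖ ≤ C := fun k ↦ (ν.norm_coeff_amice_le k).trans_eq rfl
  refine ⟨ν.amice, hA, eq_of_invAmice₁_μ_eq (p := p) (norm_coeff_mahlerD_le hA) hC ?_⟩
  -- `D_A = ν` levelwise (Amice inversion)
  have hDA : ∀ m c, (invAmice₁ p ν.amice hA).μ m c = ν.μ m c := fun m c ↦ by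
    rw [invAmice₁_μ, ← ν.invAmice₁_amice_μ m c, invAmice₁_μ]
  -- levels `≥ 1` suffice; there `D_{DA} = x · D_A = x · ν`, which is `D_P` on unit classes and `0` off them
  refine μ_eq_of_μ_succ_eq _ _ (fun n b ↦ ?_)
  rw [← density_cast_invAmice₁_μ hA (n + 1) b, BoundedDistribution.density_μ_congr hDA]
  by_cases hb : IsUnit b
  · rw [BoundedDistribution.density_μ]
    exact (μ_succ_eq_integral_density_unitInv (invAmice₁ p P hC) n b hb).symm
  · rw [hsupp n b hb]
    exact density_μ_succ_eq_zero_of_forall ν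
      (fun m c hc ↦ density_unitInv_μ_succ_of_not_isUnit (invAmice₁ p P hC) m c hc) _
      uniformContinuous_padicIntCast' (fun x ↦ norm_padicIntCast_le_one x) n b hb

/-- `BoundedPrimitive` for ANY family of bounded series whose distributions live on `ℤ_p^×`. -/
theorem boundedPrimitive_of_forall_μ_succ_eq_zero {B : Type*} (H : B → PowerSeries 𝕜) {C : ℝ}
    (hC : ∀ b k, ‖PowerSeries.coeff k (H b)‖ ≤ C)
    (hsupp : ∀ (b : B) (n : ℕ) (c : ZMod (p ^ (n + 1))), ¬ IsUnit c → (invAmice₁ p (H b) (hC b)).μ (n + 1) c = 0) :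
    BoundedPrimitive H C :=
  fun b ↦ exists_bounded_mahlerD_eq_of_forall_μ_succ_eq_zero (p := p) (hC b) (hsupp b)

/-! ### §5 (placed here: generic). The FINITE VALUE FORMULA — what READ₂ reads off the primitive -/

/-- **`A(ε − 1) = Σ_{a mod pⁿ} ν(a + pⁿℤ_p)·ε^a`** for the Amice transform `A = P_ν` of a bounded distribution
and `ε^{pⁿ} = 1`: the value of the primitive at a torsion point is a FINITE character sum of level-`n`
masses of `ν = x⁻¹·D_P` (no logarithm enters the value either). [deShalit1987, I.3.1 (1), I.3.3 (8)] -/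
theorem tsum_coeff_amice_mul_pow_eq_charSum (ν : BoundedDistribution (ProfiniteTower.padicInt p) 𝕜) (n : ℕ)
    {ε : 𝕜} (hε : ε ^ p ^ n = 1) :
    ∑' k : ℕ, PowerSeries.coeff k ν.amice * (ε - 1) ^ k = ν.charSum n ε := by
  rw [← charSum_invAmice₁_eq_tsum ν.norm_coeff_amice_le n hε, BoundedDistribution.charSum_def,
    BoundedDistribution.charSum_def]
  exact Finset.sum_congr rfl fun a _ ↦ by rw [ν.invAmice₁_amice_μ n a]

end Generic

/-! ### §4. Uniqueness of `D`-primitives: the log-currency witness is `A + const`, hence bounded for free -/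

section Uniqueness

variable {R : Type*} [CommRing R] [IsDomain R] [CharZero R]

theorem mahlerD_sub (P Q : PowerSeries R) : mahlerD (P - Q) = mahlerD P - mahlerD Q := by
  simp only [mahlerD, map_sub, mul_sub]

/-- `DQ = 0` forces `Q` to be constant (characteristic `0`): `[S^m]DQ = (m+1)q_{m+1} + m q_m`. -/
theorem eq_C_of_mahlerD_eq_zero {Q : PowerSeries R} (h : mahlerD Q = 0) :
    Q = PowerSeries.C (PowerSeries.constantCoeff Q) := by
  have key : ∀ m, PowerSeries.coeff (m + 1) Q = 0 := by
    intro m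
    induction m with
    | zero =>
      have h0 := congrArg (PowerSeries.coeff 0) h
      simp only [coeff_mahlerD, map_zero, Nat.cast_zero, zero_add, one_mul, zero_mul, add_zero] at h0
      simpa using h0
    | succ m ih =>
      have h1 := congrArg (PowerSeries.coeff (m + 1)) h
      rw [coeff_mahlerD, map_zero, ih, mul_zero, add_zero] at h1
      have hne : ((m + 1 : ℕ) : R) + 1 ≠ 0 := by exact_mod_cast Nat.succ_ne_zero (m + 1)
      exact (mul_eq_zero.mp h1).resolve_left hne
  ext n
  cases n with
  | zero => simp
  | succ m => rw [key m, PowerSeries.coeff_C, if_neg (Nat.succ_ne_zero m)]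

/-- ★ **Two `D`-primitives of the same series differ by a constant.** -/
theorem eq_add_C_of_mahlerD_eq {A A' : PowerSeries R} (h : mahlerD A = mahlerD A') :
    A = A' + PowerSeries.C (PowerSeries.constantCoeff (A - A')) := by
  have h0 : mahlerD (A - A') = 0 := by rw [mahlerD_sub, h, sub_self]
  rw [← eq_C_of_mahlerD_eq_zero h0]
  ring

/-- ★ **Bounded for free.**  If `L` is ANY `D`-primitive of `DA` with `A` bounded by `C` (e.g. the formal
log-currency witness `L_b = Ω⁻¹Θ(log̃_E g_b∘ϑ)` of k1, §10–§11 there, against the measure-side `A_b` of §2),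
then every coefficient of `L` of positive degree is bounded by `C` — de Shalit's integrality Lemma I.3.3 (7)
for `log̃` becomes a COROLLARY of the support statement (7′), not an input. -/
theorem norm_coeff_succ_le_of_mahlerD_eq {𝕜 : Type*} [NormedField 𝕜] [CharZero 𝕜] {A L : PowerSeries 𝕜}
    {C : ℝ} (hA : ∀ k, ‖PowerSeries.coeff k A‖ ≤ C) (h : mahlerD L = mahlerD A) (k : ℕ) :
    ‖PowerSeries.coeff (k + 1) L‖ ≤ C := by
  rw [eq_add_C_of_mahlerD_eq h, map_add, PowerSeries.coeff_C, if_neg (Nat.succ_ne_zero k), add_zero]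
  exact hA _

end Uniqueness

/-! ### §3. INSTANTIATION: `BoundedPrimitive` for the RELATIVE norm-coherent units at `p = 2`
(the hypotheses are VERBATIM those of ★ `seriesFamily_hsock_of_relNormCoherentUnits`) -/

section RelNormCoherentUnits

open MvPowerSeries
open ValuativeRel IsLocalRing Field
open Literature.NumberTheory.GaloisRepresentations Literature.NumberTheory.GaloisRepresentations.IsNonarchimedeanLocalField
  Literature.NumberTheory.GaloisRepresentations.LubinTate Literature.NumberTheory.PAdicHodge

variable {F : Type} [Field F] [ValuativeRel F] [TopologicalSpace F] [IsNonarchimedeanLocalField F]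

attribute [local instance] ltNormUniformSpace ltNormIsUniformAddGroup rk1 nF nE fintypeResidueField

variable (h2 : (valuation F).IsUniformizer (((2 : ℕ) : 𝒪[F]) : F)) (u : 𝒪[F]ˣ)
variable (E : IntermediateField F (AlgebraicClosure F)) [FiniteDimensional F E] [Normal F E] [IsGalois F E]
  (hq : residueFieldCard F = 2) (hE : E ≤ maxUnramified F) {σ₀ : absoluteGaloisGroup F} (hσ₀ : IsAbsArithFrob σ₀)
  (j : unitBall E →+* UnrCoeff F)
variable {ε : (maxUnramifiedCompletion F)ˣ}
  (hε : maxUnramifiedCompletion.galAut F σ₀ (ε : maxUnramifiedCompletion F) =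
    algebraMap 𝒪[F] (maxUnramifiedCompletion F) (u : 𝒪[F]) * (ε : maxUnramifiedCompletion F))
variable (θ : CompletedAlgClosure F →+* ℂ_[2]) (hθc : Continuous θ)
  (hθ1 : ∀ z : CBall F, ‖θ (z : CompletedAlgClosure F)‖ ≤ 1)
  (hθζ : ∀ ζ' : ℂ_[2], (∃ n : ℕ, ζ' ^ 2 ^ n = 1) →
    ∃ ζ : CompletedAlgClosure F, (∃ n : ℕ, ζ ^ 2 ^ n = 1) ∧ θ ζ = ζ')
  (hjC : (algebraMap (UnrCoeff F) (CBall F)).comp j = unitBallToCBall E)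

include hq hθc hθ1 hθζ hjC in
/-- ★★★ **R218 «PRIM₂» DISCHARGED (log-free)**: the relative tilde series
`H_β = Θ(j((δ_E g_β)~)∘ϑ)` of every relative norm-coherent unit `β` (base `E ⊆ F^{nr}` finite Galois,
`q = 2`, `π = u·2`) has a `D`-primitive in `ℂ₂⟦S⟧` with the same coefficient bound — from the tree's support
theorem (7′) (`invAmice₁_μ_eq_zero_of_relTraceTwo_eq_zero` ∘ `relTraceTwo_relTildeSeries`) and §2. -/
theorem exists_bounded_mahlerD_eq_relTildeSeries (β : RelNormCoherentUnits (isUniformizer_unit_mul h2 u) E) {C : ℝ}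
    (hC : ∀ k : ℕ, ‖PowerSeries.coeff k ((PowerSeries.subst (compSeriesC h2 hσ₀ u hε)
      ((relTildeSeries (isUniformizer_unit_mul h2 u) E hq hE hσ₀ (LTCoeff.of F (u : 𝒪[F])) β).map j)).map
      (θ.comp ((CBall F).subtype.comp (algebraMap (UnrCoeff F) (CBall F)))))‖ ≤ C) :
    ∃ A : PowerSeries ℂ_[2], (∀ k, ‖PowerSeries.coeff k A‖ ≤ C) ∧
      mahlerD A = (PowerSeries.subst (compSeriesC h2 hσ₀ u hε)
        ((relTildeSeries (isUniformizer_unit_mul h2 u) E hq hE hσ₀ (LTCoeff.of F (u : 𝒪[F])) β).map j)).map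
        (θ.comp ((CBall F).subtype.comp (algebraMap (UnrCoeff F) (CBall F)))) := by
  refine exists_bounded_mahlerD_eq_of_forall_μ_succ_eq_zero (p := 2) hC (fun N b hb ↦ ?_)
  have hbridge := map_subst_compSeriesC_map_eq h2 u E hσ₀ j hε θ hjC
    (relTildeSeries (isUniformizer_unit_mul h2 u) E hq hE hσ₀ (LTCoeff.of F (u : 𝒪[F])) β)
  rw [invAmice₁_μ_congr (p := 2) hbridge hC (norm_coeff_map_le_one θ hθ1 _)]
  exact invAmice₁_μ_eq_zero_of_relTraceTwo_eq_zero hq h2 hσ₀ u hε θ hθc hθ1 hθζ E _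
    (relTraceTwo_relTildeSeries (isUniformizer_unit_mul h2 u) E hq hE hσ₀ (of_unit_mul_two_eq hq u) β) N b hb

include hq hθc hθ1 hθζ hjC in
/-- ★★★ The same, in k3-g38's `BoundedPrimitive` shape for the FAMILY `b ↦ H_{η b}` of
`PAdicOneVariableSeriesFamilyOfRelNormCoherentUnits` (any index monoid `B`, any `η`, one uniform bound `C`,
as in the series-family files' `hC`). -/
theorem boundedPrimitive_relNormCoherentUnits {B : Type*} (η : B → RelNormCoherentUnits (isUniformizer_unit_mul h2 u) E)
    {C : ℝ}
    (hC : ∀ (b : B) (k : ℕ), ‖PowerSeries.coeff k ((PowerSeries.subst (compSeriesC h2 hσ₀ u hε)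
      ((relTildeSeries (isUniformizer_unit_mul h2 u) E hq hE hσ₀ (LTCoeff.of F (u : 𝒪[F])) (η b)).map j)).map
      (θ.comp ((CBall F).subtype.comp (algebraMap (UnrCoeff F) (CBall F)))))‖ ≤ C) :
    BoundedPrimitive (fun b ↦ (PowerSeries.subst (compSeriesC h2 hσ₀ u hε)
      ((relTildeSeries (isUniformizer_unit_mul h2 u) E hq hE hσ₀ (LTCoeff.of F (u : 𝒪[F])) (η b)).map j)).map
      (θ.comp ((CBall F).subtype.comp (algebraMap (UnrCoeff F) (CBall F))))) C :=
  fun b ↦ exists_bounded_mahlerD_eq_relTildeSeries h2 u E hq hE hσ₀ j hε θ hθc hθ1 hθζ hjC (η b) (hC b)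

/-- **Plan C target «`μ̃_β = μ_β|ℤ₂^×`» for the RELATIVE family** (S⁻, bookkeeping over the tree's
comparison identities): on every UNIT class the distribution of the transported tilde series
`Θ(j((δ_E g_β)~)∘ϑ)` equals that of the transported plain log-derivative `Θ(j(δ_E g_β)∘ϑ)` — the twist term
`u·((δ_E g_β)^φ∘f)` is a `[2]`-dilate after transport and dies on `ℤ₂^×`
(`invAmice₁_sub_smul_affineSeries_μ_succ_eq` below + `f∘ϑ = ϑ^φ∘[2]`). -/
def TildeMeasureEqOnUnits : Prop :=
  ∀ (β : RelNormCoherentUnits (isUniformizer_unit_mul h2 u) E) (C C₁ : ℝ)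
    (hC : ∀ k : ℕ, ‖PowerSeries.coeff k ((PowerSeries.subst (compSeriesC h2 hσ₀ u hε)
      ((relTildeSeries (isUniformizer_unit_mul h2 u) E hq hE hσ₀ (LTCoeff.of F (u : 𝒪[F])) β).map j)).map
      (θ.comp ((CBall F).subtype.comp (algebraMap (UnrCoeff F) (CBall F)))))‖ ≤ C)
    (hC₁ : ∀ k : ℕ, ‖PowerSeries.coeff k ((PowerSeries.subst (compSeriesC h2 hσ₀ u hε)
      ((relLogDerivSeries (isUniformizer_unit_mul h2 u) E hq hE hσ₀ β).map j)).map
      (θ.comp ((CBall F).subtype.comp (algebraMap (UnrCoeff F) (CBall F)))))‖ ≤ C₁)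
    (N : ℕ) (b : ZMod (2 ^ (N + 1))), IsUnit b →
    (invAmice₁ 2 ((PowerSeries.subst (compSeriesC h2 hσ₀ u hε)
      ((relTildeSeries (isUniformizer_unit_mul h2 u) E hq hE hσ₀ (LTCoeff.of F (u : 𝒪[F])) β).map j)).map
      (θ.comp ((CBall F).subtype.comp (algebraMap (UnrCoeff F) (CBall F))))) hC).μ (N + 1) b =
    (invAmice₁ 2 ((PowerSeries.subst (compSeriesC h2 hσ₀ u hε)
      ((relLogDerivSeries (isUniformizer_unit_mul h2 u) E hq hE hσ₀ β).map j)).map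
      (θ.comp ((CBall F).subtype.comp (algebraMap (UnrCoeff F) (CBall F))))) hC₁).μ (N + 1) b

end RelNormCoherentUnits

/-! ### §6. What READ₂ (R219) still needs, retyped after §2–§5 (statements only; no named facts) -/

section ReadInputs

variable {p : ℕ} [Fact p.Prime]
variable (𝕜 : Type*) [NormedField 𝕜] [NormedAlgebra ℚ_[p] 𝕜] [IsUltrametricDist 𝕜] [CompleteSpace 𝕜] [CharZero 𝕜]

/-- The `p`-adic logarithm series on principal units, inline
(`= Literature.IUT.LogVolume.logSeries` / `IwasawaLog`'s series / `padicLogSeriesAlgCl` of the tree). -/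
def logU (y : 𝕜) : 𝕜 := ∑' n : ℕ, -((1 - y) ^ (n + 1)) / ((n : 𝕜) + 1)

/-- **READ₂ input (b) «LOG-EVALUATION COMMUTES»** (S): evaluating Mathlib's FORMAL `PowerSeries.logOf g`
(`g` integral, `g(0) = 1`) at a point of the open unit disc gives the `p`-adic log of the value `g(x)`.
True by unconditional summability of the double family `([S^k](g−1)^n / n · x^k)_{n ≤ k}` (terms `→ 0`:
`‖1/n‖·‖x‖^k ≤ k‖x‖^k` for `k ≥ n`); it is the only place a logarithm enters the line after §2. -/
def LogOfEvalCommutes : Prop :=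
  ∀ (g : PowerSeries 𝕜), (∀ k, ‖PowerSeries.coeff k g‖ ≤ 1) → PowerSeries.constantCoeff g = 1 →
    ∀ x : 𝕜, ‖x‖ < 1 →
      HasSum (fun k : ℕ ↦ PowerSeries.coeff k (PowerSeries.logOf g) * x ^ k)
        (logU 𝕜 (∑' k : ℕ, PowerSeries.coeff k g * x ^ k))

variable {𝕜} in
/-- ★ **READ₂ input (c) «THE FROBENIUS-TWIST TERM DIES ON THE UNITS» — PROVED** (generic measure
algebra, every `p`): the distribution of `H ∘ [p] = H((1+S)^p − 1)` (tree currency: `affineSeries 0 p H =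
(1+S)^0 · binomDilate p H`) is the push-forward `(p·)_* D_H` (tree ★ `affinePush_invAmice₁_μ`), hence vanishes
on every UNIT class of level `≥ 1` (tree `affinePush_μ_succ_eq_zero` at `a = 0`).  Consequence for the line
(Plan C): in `H_β = Θ(j((δ_E g_β)~)∘ϑ) = H₁ − u·Θ((δ_E g_β)^φ∘f∘ϑ)` the second term is `u · (H₂ ∘ [2])`
(`f∘ϑ = ϑ^φ∘[2]`, `H₂ := Θ(((δ_E g_β)∘ϑ)^φ)`), so its distribution is invisible on `ℤ₂^×`:
`D_{H_β} = D_{H₁}|_{ℤ₂^×}` ("`μ̃_β = μ_β|ℤ_p^×`", de Shalit I.3.3 after (7′)) and `x⁻¹·D_{H_β} = (x⁻¹·D_{H₁})|`. -/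
theorem invAmice₁_affineSeries_zero_μ_succ_eq_zero_of_isUnit {H : PowerSeries 𝕜} {C : ℝ}
    (hC : ∀ k, ‖PowerSeries.coeff k H‖ ≤ C) (n : ℕ) (c : ZMod (p ^ (n + 1))) (hc : IsUnit c) :
    (invAmice₁ p (affineSeries 0 (p : ℤ_[p]) H) (norm_coeff_affineSeries_le hC 0 p)).μ (n + 1) c = 0 := by
  have hp : p.Prime := Fact.out
  haveI : Fact (1 < p ^ 1) := ⟨by rw [pow_one]; exact hp.one_lt⟩
  rw [← affinePush_invAmice₁_μ hC 0 (p : ℤ_[p]) (n + 1) c]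
  refine (invAmice₁ p H hC).affinePush_μ_succ_eq_zero 0 n c ?_
  rw [map_zero]
  exact (hc.map _).ne_zero

variable {𝕜} in
/-- … and with the unit scalar and an additive main term: on unit classes `D_{H₁ − u·(H₂∘[p])} = D_{H₁}`
(tree `invAmice₁_add_μ` / `invAmice₁_smul_μ` bookkeeping; stated here as the target shape of Plan C). -/
theorem invAmice₁_sub_smul_affineSeries_μ_succ_eq {H₁ H₂ : PowerSeries 𝕜} {C : ℝ} (u : 𝕜)
    (hC₁ : ∀ k, ‖PowerSeries.coeff k H₁‖ ≤ C) (hC₂ : ∀ k, ‖PowerSeries.coeff k H₂‖ ≤ C)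
    {C' : ℝ} (hC' : ∀ k, ‖PowerSeries.coeff k (H₁ + (-u) • affineSeries 0 (p : ℤ_[p]) H₂)‖ ≤ C')
    {C'' : ℝ} (hC'' : ∀ k, ‖PowerSeries.coeff k ((-u) • affineSeries 0 (p : ℤ_[p]) H₂)‖ ≤ C'')
    (n : ℕ) (c : ZMod (p ^ (n + 1))) (hc : IsUnit c) :
    (invAmice₁ p (H₁ + (-u) • affineSeries 0 (p : ℤ_[p]) H₂) hC').μ (n + 1) c = (invAmice₁ p H₁ hC₁).μ (n + 1) c := by
  rw [invAmice₁_add_μ hC₁ hC'' hC' (n + 1) c,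
    invAmice₁_smul_μ (norm_coeff_affineSeries_le hC₂ 0 p) (-u) hC'' (n + 1) c,
    invAmice₁_affineSeries_zero_μ_succ_eq_zero_of_isUnit hC₂ n c hc, mul_zero, add_zero]

end ReadInputs

end Summit.BirchSwinnertonDyer.BirchSwinnertonDyer.Cruxes.SplitBadTwoLowerHalfOfFacts.LogFreePrimitiveK2G39

end
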